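import Mathlib
import Summits.Ventures.Crystal3D.Theorems.StickyWulffConstantLayerChainDefs
import Summits.Ventures.Crystal3D.Theorems.StickyWulffConstantStackingLiminfLayerChainV4Defs
import Summits.Ventures.Crystal3D.Theorems.StickyWulffConstantStackingLiminfModulatedWulff
import Summits.Ventures.Crystal3D.Theorems.StickyWulffConstantStackingLiminfPairingBound
import Summits.Ventures.Crystal3D.Theorems.StickyWulffConstantStackingLiminfLayerSplit
import HarnessLib

/-!
# The two-phase pairing bound for a layered family of functions (stub (B) `MollifiedUpper`, line
# LayerChain v4, crux `StackingLiminf`, stmt-Ventures-19145): pointwise form over `negGrad`/`fderiv`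

Cell `crystal3d-full`, venture `Summits/Ventures/Crystal3D`.  BLUEPRINT-v4B (S3) in calculus form: for ANY
finite family of differentiable functions `w_n` (`n < m`, padded: `w_0 = w_m = 0`) with letters `s n`, total
`w = Σ_n w_n`, `−1`-phase part `W⁻ = Σ_{s n ≠ 1} w_n`, and any profile `g` with values in `[0,1]`, at every
point `y`:

`stackTension (g y₂) (negGrad w y) ≤ Σ_i Σ_n |Dw_n(y) a_i| + Σ_n Σ_i |−Dw_n(y) b_{s n,i} + w_n(y) − w_{n+1}(y)|`
`                                   + Σ_i |−DW⁻(y) c_i + g(y₂) Dw(y) c_i|`,  `c_i = bPlus i − bMinus i`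

(`stackTension_le_pairing`, p515111, with `m_n = negGrad w_n y`, `d_n = w_n(y) − w_{n+1}(y)`, which telescope
to `w_0(y) − w_m(y) = 0`; `negGrad` of a sum is the sum, `dot3 (negGrad w y) u = −Dw(y)u`).  The first sum is
written as `|−Dw_n(y)a_i + w_n(y) − w_n(y)|` so that both families are instances of the per-class defect of
`…ClassReduction`.  Applied to the lateral averages of the layer densities this is the integrand of stub (B).
WHAT THIS IS NOT: stub (B); rung F-C1 not moved.
-/

noncomputable section

namespace Summit.Ventures.Crystal3D.Theorems

open Summit.Ventures.Crystal3D.LayerChain (dot3 aVec bPlus bMinus stackTension)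
open Summit.Ventures.Crystal3D.Cruxes.StackingLiminf.LayerChainV4 (negGrad)

/-- `dot3 (negGrad w y) u = −Dw(y) u`. -/
theorem dot3_negGrad_left (w : (Fin 3 → ℝ) → ℝ) (y u : Fin 3 → ℝ) :
    dot3 (negGrad w y) u = -(fderiv ℝ w y u) := by
  rw [dot3_comm, fderiv_apply_eq_neg_dot3_negGrad w y u, neg_neg]

/-- **The skew term of the pairing bound is `−DW(y)c_i + g(y₂)Dw(y)c_i`** with `c_i = bPlus i − bMinus i`,
for `e = negGrad W y − g(y₂) • negGrad w y`. -/
theorem skew_pairing_term_eq (W w : (Fin 3 → ℝ) → ℝ) (g : ℝ → ℝ) (y : Fin 3 → ℝ) (i : Fin 3) :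
    dot3 (negGrad W y - g (y 2) • negGrad w y) (bPlus i) - dot3 (negGrad W y - g (y 2) • negGrad w y) (bMinus i)
      = -(fderiv ℝ W y (bPlus i - bMinus i)) + g (y 2) * fderiv ℝ w y (bPlus i - bMinus i) := by
  rw [← dot3_sub_right, dot3_sub_left, dot3_smul_left,
    dot3_negGrad_left, dot3_negGrad_left]
  ring

/-- **Pointwise two-phase pairing bound for a padded layered family.** -/
theorem stackTension_negGrad_le_layers (w : ℕ → (Fin 3 → ℝ) → ℝ) (m : ℕ) (s : ℕ → ℤ) (g : ℝ → ℝ)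
    (hg : ∀ t, 0 ≤ g t ∧ g t ≤ 1) (y : Fin 3 → ℝ) (hw : ∀ n, DifferentiableAt ℝ (w n) y)
    (h0 : w 0 y = 0) (hm : w m y = 0) :
    stackTension (g (y 2)) (negGrad (fun y' => ∑ n ∈ Finset.range m, w n y') y) ≤
      (∑ i : Fin 3, ∑ n ∈ Finset.range m, |-(fderiv ℝ (w n) y (aVec i)) + w n y - w n y|) +
      (∑ n ∈ Finset.range m, ∑ i : Fin 3,
        |-(fderiv ℝ (w n) y (if s n = 1 then bPlus i else bMinus i)) + w n y - w (n + 1) y|) +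
      ∑ i : Fin 3, |-(fderiv ℝ (fun y' => ∑ n ∈ (Finset.range m).filter (fun n => s n ≠ 1), w n y') y
            (bPlus i - bMinus i)) +
          g (y 2) * fderiv ℝ (fun y' => ∑ n ∈ Finset.range m, w n y') y (bPlus i - bMinus i)| := by
  have hng : negGrad (fun y' => ∑ n ∈ Finset.range m, w n y') y = ∑ n ∈ Finset.range m, negGrad (w n) y :=
    negGrad_finset_sum _ _ _ fun n _ => hw n
  have hngm : negGrad (fun y' => ∑ n ∈ (Finset.range m).filter (fun n => s n ≠ 1), w n y') y =
      ∑ n ∈ (Finset.range m).filter (fun n => s n ≠ 1), negGrad (w n) y :=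
    negGrad_finset_sum _ _ _ fun n _ => hw n
  have hd : ∑ n ∈ Finset.range m, (w n y - w (n + 1) y) = 0 := by
    rw [Finset.sum_range_sub', h0, hm, sub_zero]
  have hP := stackTension_le_pairing (g (y 2)) (hg _).1 (hg _).2 (Finset.range m) s
    (fun n => negGrad (w n) y) (fun n => w n y - w (n + 1) y) hd
  rw [hng]
  refine le_trans hP (add_le_add_three ?_ ?_ ?_)
  · -- in-plane part
    refine Finset.sum_le_sum fun i _ => ?_
    rw [dot3_sum_left]
    refine le_trans (Finset.abs_sum_le_sum_abs _ _) (Finset.sum_le_sum fun n _ => ?_)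
    rw [dot3_negGrad_left, add_sub_cancel_right]
  · -- cross part
    refine Finset.sum_le_sum fun n _ => Finset.sum_le_sum fun i _ => ?_
    rw [dot3_negGrad_left, add_sub]
  · -- skew part
    refine Finset.sum_le_sum fun i _ => ?_
    rw [← hng, ← hngm, ← skew_pairing_term_eq]

end Summit.Ventures.Crystal3D.Theorems

end
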